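import Mathlib.RingTheory.Nullstellensatz
import Mathlib.RingTheory.MvPolynomial.Homogeneous
import Mathlib.RingTheory.GradedAlgebra.Homogeneous.Ideal
import Mathlib.LinearAlgebra.Matrix.NonsingularInverse
import Mathlib.Algebra.Order.Antidiag.Finsupp
import HarnessLib

/-!
# The locus where a family of forms acquires a common zero is Zariski closed (constructive form)

Topic: `Literature/RingTheory/MvPolynomial`. Let `K` be an algebraically closed field, let
`G_i(x; w) ∈ K[x][w]` (`i ∈ ι`, finitely many) be polynomials in the variables `w = (w_j)_{j ∈ τ}`
(finitely many) whose coefficients are polynomials in the parameters `x = (x_s)_{s ∈ σ}`, each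
homogeneous in `w`. The set of parameters `x ∈ K^σ` at which the specialised forms `G_i(x; ·)`
have a common NONTRIVIAL zero `w ≠ 0` is Zariski closed — the main theorem of elimination
theory for projective space (`ℙ^{τ}` is complete: the image in `K^σ` of a closed subset of
`K^σ × ℙ^τ` is closed; van der Waerden, *Moderne Algebra II* (1931), §80 "Der Hauptsatz der
Eliminationstheorie"; Shafarevich, *Basic Algebraic Geometry 1*, Ch. I §5.2 Thm. 3; Cox–Little–
O'Shea, *Ideals, Varieties, and Algorithms*, Ch. 8 §5 Thm. 6 (projective extension theorem)).
We prove it in the following CONSTRUCTIVE, point-by-point form, which is what specialisation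
arguments use:

* **`exists_eval_ne_zero_not_hasCommonZero`** — if at `x₀` the forms `G_i(x₀; ·)` have no common
  nontrivial zero, then there is a polynomial `Δ ∈ K[x]` with `Δ(x₀) ≠ 0` such that the
  `G_i(x; ·)` have no common nontrivial zero at any `x` with `Δ(x) ≠ 0`.

Proof (the classical one through the projective Nullstellensatz and "inertia forms", made
explicit): by Hilbert's Nullstellensatz (Mathlib `MvPolynomial.vanishingIdeal_zeroLocus_eq_radical`)
every monomial `w^α` of some degree `N` lies in the ideal of the `G_i(x₀; ·)`
(`exists_X_pow_mem_span`, `monomial_mem_of_forall_X_pow_mem`), say `w^α = Σ_i H_{α i} G_i(x₀; ·)`; the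
"universal" elements `E_α(x) = Σ_i H_{α i} G_i(x; ·)` have degree-`N` coefficients forming a
square matrix `C(x)` of polynomials in `x` with `C(x₀) = 1`; put `Δ = det C`. Where
`Δ(x) ≠ 0`, inverting `C(x)` writes every `w^β` (`|β| = N`) as the degree-`N` homogeneous
component of an element of the (homogeneous) ideal of the `G_i(x; ·)`, hence as an element of it;
so a common zero `w` has `w_j^N = 0` for all `j`.

## References

* I. R. Shafarevich, *Basic Algebraic Geometry 1*, 2nd ed. (1994), Ch. I §5.2, Theorem 3.
  [Shafarevich1994]
* D. Cox, J. Little, D. O'Shea, *Ideals, Varieties, and Algorithms*, 3rd ed. (2007), Ch. 8 §5,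
  Theorem 6 (projective extension theorem); Ch. 8 §3, Theorem 8 (projective weak
  Nullstellensatz). [CoxLittleOShea2007]
* B. L. van der Waerden, *Moderne Algebra II* (1931), §80 (Hauptsatz der Eliminationstheorie).
-/

open MvPolynomial Finset Matrix

attribute [local instance] MvPolynomial.gradedAlgebra

namespace Literature.RingTheory.MvPolynomial

variable {K : Type*} [Field K] {σ τ ι : Type*}

/-- The specialised forms `G_i(x; ·) ∈ K[w]` (coefficients evaluated at `x`) have a common
nontrivial zero `w ≠ 0`. [cite: Shafarevich1994, Ch. I §5.2] -/
def HasCommonZero (G : ι → MvPolynomial τ (MvPolynomial σ K)) (x : σ → K) : Prop :=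
  ∃ w : τ → K, w ≠ 0 ∧ ∀ i, eval w (map (eval x) (G i)) = 0

/-- **Projective Nullstellensatz (the case of the irrelevant ideal).** If the polynomials `g_i`
have no common zero other than `w = 0`, then some power of every variable lies in the ideal they
generate. [cite: CoxLittleOShea2007, Ch. 8 §3, Theorem 8 (projective weak Nullstellensatz)] -/
theorem exists_X_pow_mem_span [IsAlgClosed K] [Finite τ] (g : ι → MvPolynomial τ K)
    (h : ∀ w : τ → K, (∀ i, eval w (g i) = 0) → w = 0) (j : τ) :
    ∃ n : ℕ, (X j : MvPolynomial τ K) ^ n ∈ Ideal.span (Set.range g) := by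
  have hX : (X j : MvPolynomial τ K) ∈
      vanishingIdeal K (zeroLocus K (Ideal.span (Set.range g))) := by
    rw [mem_vanishingIdeal_iff]
    intro w hw
    have hw0 : w = 0 := h w fun i => by
      have := (mem_zeroLocus_iff.1 hw) (g i) (Ideal.subset_span ⟨i, rfl⟩)
      rwa [MvPolynomial.aeval_eq_eval] at this
    rw [hw0, MvPolynomial.aeval_eq_eval, eval_X, Pi.zero_apply]
  rw [vanishingIdeal_zeroLocus_eq_radical] at hX
  exact hX

/-- Over a finite index set, `Finsupp.degree` is the plain sum of the values. [folklore] -/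
theorem finsuppDegree_eq_univ_sum [Fintype τ] (β : τ →₀ ℕ) : β.degree = ∑ j, β j := by
  classical
  unfold Finsupp.degree
  exact Finset.sum_subset (subset_univ _) fun j _ hj => Finsupp.notMem_support_iff.1 hj

/-- If `X_j^{n_j}` lies in an ideal for every variable, then so does every monomial of degree
at least `Σ_j n_j` (there are only finitely many variables, at least one). [folklore] -/
theorem monomial_mem_of_forall_X_pow_mem [Fintype τ] [Nonempty τ] {I : Ideal (MvPolynomial τ K)}
    (n : τ → ℕ) (hn : ∀ j, (X j : MvPolynomial τ K) ^ n j ∈ I) (β : τ →₀ ℕ)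
    (hβ : ∑ j, n j ≤ β.degree) : monomial β (1 : K) ∈ I := by
  classical
  by_cases h : ∃ j, n j ≤ β j
  · obtain ⟨j, hj⟩ := h
    have hle : Finsupp.single j (n j) ≤ β := Finsupp.single_le_iff.2 hj
    have : monomial β (1 : K) =
        monomial (β - Finsupp.single j (n j)) (1 : K) * (X j : MvPolynomial τ K) ^ n j := by
      rw [X_pow_eq_monomial, monomial_mul, one_mul, tsub_add_cancel_of_le hle]
    rw [this]
    exact I.mul_mem_left _ (hn j)
  · push Not at h
    exfalso
    rw [finsuppDegree_eq_univ_sum] at hβ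
    have : ∑ j, β j < ∑ j, n j :=
      Finset.sum_lt_sum_of_nonempty univ_nonempty fun j _ => h j
    omega

/-- The degree-`N` homogeneous component of `p` written in the monomial basis indexed by all
exponents of degree `N`. [folklore] -/
theorem homogeneousComponent_eq_sum_finsuppAntidiag [Fintype τ] [DecidableEq τ] (N : ℕ)
    (p : MvPolynomial τ K) :
    homogeneousComponent N p =
      ∑ β ∈ (univ : Finset τ).finsuppAntidiag N, monomial β (coeff β p) := by
  ext d
  rw [coeff_homogeneousComponent, coeff_sum]
  simp_rw [coeff_monomial]
  rw [Finset.sum_ite_eq']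
  have hmem : d ∈ (univ : Finset τ).finsuppAntidiag N ↔ d.degree = N := by
    rw [mem_finsuppAntidiag, finsuppDegree_eq_univ_sum]
    simp
  by_cases hd : d.degree = N
  · rw [if_pos hd, if_pos (hmem.2 hd)]
  · rw [if_neg hd, if_neg (fun h' => hd (hmem.1 h'))]

/-- Evaluation of a polynomial at a common zero of generators of an ideal kills the ideal.
[folklore] -/
theorem eval_eq_zero_of_mem_span (g : ι → MvPolynomial τ K) (w : τ → K)
    (hw : ∀ i, eval w (g i) = 0) {p : MvPolynomial τ K} (hp : p ∈ Ideal.span (Set.range g)) :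
    eval w p = 0 := by
  refine Submodule.span_induction (p := fun q _ => eval w q = 0) ?_ (map_zero _) ?_ ?_ hp
  · rintro _ ⟨i, rfl⟩; exact hw i
  · intro a b _ _ ha hb; rw [map_add, ha, hb, add_zero]
  · intro c a _ ha; rw [smul_eq_mul, map_mul, ha, mul_zero]

/-- **The set of parameters where forms acquire a common zero is closed** (constructive form of
the main theorem of elimination theory): if the forms `G_i(x₀; ·)` (homogeneous in `w`, with
coefficients polynomial in `x`) have no common nontrivial zero, there is `Δ ∈ K[x]` with
`Δ(x₀) ≠ 0` such that for every `x` with `Δ(x) ≠ 0` the forms `G_i(x; ·)` have no common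
nontrivial zero either. [cite: Shafarevich1994, Ch. I §5.2, Theorem 3]
[cite: CoxLittleOShea2007, Ch. 8 §5, Theorem 6 (projective extension theorem)] -/
theorem exists_eval_ne_zero_not_hasCommonZero [IsAlgClosed K] [Fintype τ] [Fintype ι]
    (G : ι → MvPolynomial τ (MvPolynomial σ K)) (e : ι → ℕ)
    (hG : ∀ i, (G i).IsHomogeneous (e i)) {x₀ : σ → K} (h0 : ¬ HasCommonZero G x₀) :
    ∃ Δ : MvPolynomial σ K, eval x₀ Δ ≠ 0 ∧ ∀ x, eval x Δ ≠ 0 → ¬ HasCommonZero G x := by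
  classical
  rcases isEmpty_or_nonempty τ with hτ | hτ
  · exact ⟨1, by rw [map_one]; exact one_ne_zero,
      fun x _ ⟨w, hw, _⟩ => hw (Subsingleton.elim _ _)⟩
  -- Step 1: Nullstellensatz at `x₀`
  set g : ι → MvPolynomial τ K := fun i => map (eval x₀) (G i) with hg
  have hzero : ∀ w : τ → K, (∀ i, eval w (g i) = 0) → w = 0 := by
    intro w hw
    by_contra hw0
    exact h0 ⟨w, hw0, hw⟩
  choose n hn using fun j => exists_X_pow_mem_span g hzero j
  set N : ℕ := ∑ j, n j with hN
  set B : Finset (τ →₀ ℕ) := (univ : Finset τ).finsuppAntidiag N with hB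
  have hBdeg : ∀ β ∈ B, β.degree = N := by
    intro β hβ
    rw [hB, mem_finsuppAntidiag] at hβ
    rw [finsuppDegree_eq_univ_sum]; exact hβ.1
  have hmono : ∀ β ∈ B, monomial β (1 : K) ∈ Ideal.span (Set.range g) := fun β hβ =>
    monomial_mem_of_forall_X_pow_mem n hn β (hBdeg β hβ).symm.le
  -- Step 2: Bézout coefficients and the universal elements `E_β`
  have hH : ∀ β ∈ B, ∃ c : ι → MvPolynomial τ K, ∑ i, c i * g i = monomial β 1 := fun β hβ =>
    Ideal.mem_span_range_iff_exists_fun.1 (hmono β hβ)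
  choose! H hH using hH
  set E : (τ →₀ ℕ) → MvPolynomial τ (MvPolynomial σ K) :=
    fun β => ∑ i, map C (H β i) * G i with hE_def
  have hCid : ∀ x : σ → K, (eval x).comp (C : K →+* MvPolynomial σ K) = RingHom.id K :=
    fun x => RingHom.ext fun c => eval_C c
  have hE : ∀ (x : σ → K) β, map (eval x) (E β) = ∑ i, H β i * map (eval x) (G i) := by
    intro x β
    rw [hE_def]
    simp only [_root_.map_sum, _root_.map_mul, MvPolynomial.map_map]
    refine Finset.sum_congr rfl fun i _ => ?_
    rw [hCid x, MvPolynomial.map_id]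
  have hE₀ : ∀ β ∈ B, map (eval x₀) (E β) = monomial β 1 := fun β hβ => by rw [hE, hH β hβ]
  -- Step 3: the matrix of degree-`N` coefficients and its determinant
  set CR : Matrix B B (MvPolynomial σ K) := fun α β => coeff β.1 (E α.1) with hCR
  have hCx : ∀ x : σ → K, (eval x).mapMatrix CR = fun α β => coeff β.1 (map (eval x) (E α.1)) := by
    intro x; ext α β; simp [hCR, coeff_map]
  refine ⟨CR.det, ?_, ?_⟩
  · rw [RingHom.map_det, hCx]
    have h1 : (fun α β : B => coeff β.1 (map (eval x₀) (E α.1))) = (1 : Matrix B B K) := by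
      ext α β
      rw [hE₀ α.1 α.2, coeff_monomial, Matrix.one_apply]
      simp only [Subtype.ext_iff]
    rw [h1, det_one]
    exact one_ne_zero
  · rintro x hx ⟨w, hw0, hw⟩
    apply hw0
    set Cx : Matrix B B K := (eval x).mapMatrix CR with hCx_def
    have hdet : IsUnit Cx.det := by
      rw [hCx_def, ← RingHom.map_det]
      exact (Ne.isUnit hx)
    -- the homogeneous ideal of the specialised forms at `x`
    set Ix : Ideal (MvPolynomial τ K) := Ideal.span (Set.range fun i => map (eval x) (G i))
      with hIx_def
    have hIx : Ix.IsHomogeneous (homogeneousSubmodule τ K) := by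
      refine Ideal.homogeneous_span (homogeneousSubmodule τ K) _ ?_
      rintro _ ⟨i, rfl⟩
      exact ⟨e i, (mem_homogeneousSubmodule _ _).2 ((hG i).map _)⟩
    have hEx : ∀ β, map (eval x) (E β) ∈ Ix := by
      intro β
      rw [hE]
      exact Ideal.sum_mem _ fun i _ => Ideal.mul_mem_left _ _ (Ideal.subset_span ⟨i, rfl⟩)
    -- degree-`N` components in the monomial basis
    have hcomp : ∀ α : B, homogeneousComponent N (map (eval x) (E α.1)) =
        ∑ β : B, Cx α β • monomial β.1 (1 : K) := by
      intro α
      rw [homogeneousComponent_eq_sum_finsuppAntidiag, ← hB, ← Finset.sum_coe_sort B]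
      refine Finset.sum_congr rfl fun β _ => ?_
      rw [hCx_def, hCx, smul_monomial, smul_eq_mul, mul_one]
    have hmonoIx : ∀ β : B, monomial β.1 (1 : K) ∈ Ix := by
      intro β
      have key : monomial β.1 (1 : K) =
          ∑ α : B, (Cx⁻¹) β α • homogeneousComponent N (map (eval x) (E α.1)) := by
        simp_rw [hcomp, Finset.smul_sum, smul_smul]
        rw [Finset.sum_comm]
        simp_rw [← Finset.sum_smul]
        have hmul : ∀ γ : B, ∑ α : B, (Cx⁻¹) β α * Cx α γ = (1 : Matrix B B K) β γ := by
          intro γ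
          rw [← nonsing_inv_mul Cx hdet, Matrix.mul_apply]
        simp_rw [hmul, Matrix.one_apply, ite_smul, one_smul, zero_smul]
        rw [Finset.sum_ite_eq]
        simp
      rw [key]
      refine Ideal.sum_mem _ fun α _ => ?_
      rw [smul_eq_C_mul]
      exact Ideal.mul_mem_left _ _ (homogeneousComponent_mem_of_mem hIx (hEx α.1) N)
    -- `w_j ^ N ∈ Ix`, hence `w_j = 0`
    have hvan : ∀ p ∈ Ix, eval w p = 0 := fun p hp =>
      eval_eq_zero_of_mem_span (fun i => map (eval x) (G i)) w hw hp
    funext j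
    have hβ : Finsupp.single j N ∈ B := by
      rw [hB, mem_finsuppAntidiag]
      refine ⟨?_, subset_univ _⟩
      simp [Finsupp.single_apply]
    have hXN := hvan _ (hmonoIx ⟨_, hβ⟩)
    rw [← X_pow_eq_monomial, map_pow, eval_X] at hXN
    rcases Nat.eq_zero_or_pos N with hN0 | hNpos
    · rw [hN0, pow_zero] at hXN
      exact absurd hXN one_ne_zero
    · exact pow_eq_zero_iff hNpos.ne' |>.1 hXN
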